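import Mathlib
import Summits.ResolutionOfSingularities.ResolutionOfSingularities.Theorems.WeightedInvariantLocalWeightedDropNCResSurfGraphShadow
import Summits.ResolutionOfSingularities.ResolutionOfSingularities.Theorems.WeightedInvariantLocalWeightedDropNCResSurfGraphEndgame
import Summits.ResolutionOfSingularities.ResolutionOfSingularities.Theorems.WeightedInvariantLocalWeightedDropNCResSurfGraphNCTwist
import Summits.ResolutionOfSingularities.ResolutionOfSingularities.Theorems.WeightedInvariantLocalWeightedDropPlaneCountRadical
import Summits.ResolutionOfSingularities.ResolutionOfSingularities.Theorems.WeightedInvariantLocalWeightedDropNCResSurfGraphApexFour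

/-!
# `WeightedInvariant.LocalWeightedDrop`: NC-resolution settings for the TOT₂ line — GRAPH SURFACES, part 29: THE LOOP `SurfLoop`, THE SURFACE
# SUB-CASE `ApexPlaneSurfaceExit`, AND res-L1-w43-strat-1's STUB `stub_apexPlaneSurfaceThree` — PROVED

Crux item stmt-ResolutionOfSingularities-8899 `LocalWeightedDrop` (route `ResolutionOfSingularities/WeightedInvariant`), ENGINE skeleton v34/v35
(res-L1-w43-lead-1), residual `stub_wildWideApexFourStartsWon` (W′|₄); res-L1-w43-strat-1's line `directrix-cut` v3f (37b4c92427ddabdc) with its PL₃ piece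
`stub_apexPlaneThree` (`ApexPlaneExit k 3`), re-cut by the sub-skeleton `L/res-L1-w43-strat-1/g9/pl3_split_v1.lean` (7519a9009475ab47) into
`stub_apexPlaneSurfaceThree` (SURFACE) ∧ `stub_apexPlaneLowEscapeThree` (LOW).  THIS FILE PROVES THE SURFACE STUB'S TEXT (`apexPlaneSurfaceThree`), in every
ambient dimension `m + 1 ≥ 3` over every infinite field (`surfLoop`, `apexPlaneSurfaceExit`).  Design memo `L/res-L1-w43-stub-4/g6/SURFLOOP-DESIGN.md`.
[OURS · L1 W4.3 · chain w43 · seat res-L1-w43-stub-4 gen 6; def-free assembly of parts 1–28 (…NCResSurfGraph*) with the tree theorem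
`stub_planeCountRadical` (strong embedded resolution of plane curve germs in chart form, radical-monotone count; Hartshorne V.3.9) and the decorated
count-game calculus `DWinsTo` (res-L1-w43-stub-1 / res-L1-w43-strat-1); the count game is the programme's own; nothing here is a statement of any
manuscript; AI-produced, gate-checked, weaker than expert review.]

THE ARGUMENT (S-E2-SURF = «log-resolution of the boundary traces on the permissible surface `S`, the opponent choosing the points»).  A loop state is
an admissibly decorated position with a permissible graph surface `S` over two base letters and apex dimension `≤ 2`; its SHADOW is the plane germ
`x₀^{[a∈E]} x₁^{[b∈E]} ∏ ψ_l` of the boundary traces on `S`.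
(1) NON-NORMAL-CROSSING PHASE (part 21, `dWinsTo_ncShadow`): point moves only; the successor's shadow divides a power of the slice germ named by the drop
clause of `PlaneGermNonNCCountRad`, so the count `ν(shadow)` drops at every same-head answer.
(2) NORMAL-CROSSING PHASE (`dWinsTo_of_ncShadow`): a normal-crossing shadow becomes MONOMIAL after one legal re-coordinatisation of the base plane fixing
the boundary base letters (part 28); validity and the head pass to the twisted state and a win from it is a win from the state (part 27); the MONOMIAL
ENDGAME (part 26: curve moves along the base axes when every trace contains the axis, point moves otherwise) admits no infinite play by the combinatorial
theorem of part 22, and its terminal states (every boundary trace off the base vanishes) exit by the SURFACE MOVE (part 1, `dWinsTo_headDrop_of_terminal`).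
(3) `surfLoop` binds the two phases on the decorated states; `apexPlaneSurfaceExit` is part 17's reduction; `apexPlaneSurfaceThree` adds part 18
(`¬ UnaryVertex ⇒` apex dimension `≤ 2` at four letters) and the weighted-order form of permissibility (part 27's `inOffPlaneIdeal_of_le_weightedOrder`).

* **`SurfDatum.dWinsTo_of_ncShadow`**, **`surfLoop : SurfLoop k m`** (`k` infinite, `m ≥ 2`), **`apexPlaneSurfaceExit : ApexPlaneSurfaceExit k m`**,
  **`apexPlaneSurfaceThree`** = the text of `stub_apexPlaneSurfaceThree` (its hypotheses `O = ∅` and «two independent invariance vectors» are not needed).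
-/

set_option linter.dupNamespace false -- mandated namespace of this single-conjunct summit

noncomputable section

namespace Summit.ResolutionOfSingularities.ResolutionOfSingularities.Theorems

namespace TameFourTupleDrop

namespace GraphSurf

open MvPowerSeries Literature.AlgebraicGeometry.Resolution

variable {k : Type} [Field k] {m : ℕ}

namespace SurfDatum

/-- **THE NORMAL-CROSSING PHASE** (OURS · L1 W4.3; memo §2–§3): from a valid loop state whose shadow is a normal crossing (`m ≥ 2`), the mover forces
«admissibly decorated of smaller head»: twist to a monomial state (part 28), run the monomial endgame (part 26), exit by the surface move from the
terminal states (part 1), and pull the win back through the twist (part 27). -/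
theorem dWinsTo_of_ncShadow [Infinite k] (hm : 2 ≤ m) {σ : SurfDatum k m} (hσ : σ.Valid) (hnc : PlaneGerm.IsNC σ.shadow) :
    DWinsTo (St := MvPowerSeries (Fin (m + 1)) k × Decoration k m) Prod.fst
      (fun τ => Admissible τ.1 τ.2 ∧ τ.2.head < σ.δ.head) (σ.b₀, σ.δ) := by
  obtain ⟨Θ, hΘ0, hΘdet, hΘa, hΘb, e, hmono⟩ := exists_monomial_twist hnc
  obtain ⟨hval, hhead⟩ := hσ.twist hΘ0 hΘdet hΘa hΘb
  -- the endgame from the twisted state, mapped to the decorated states and followed by the terminal exit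
  have hend := dWinsTo_endgame hval hmono
  have hmap := hend.map (germ := (Prod.fst : MvPowerSeries (Fin (m + 1)) k × Decoration k m → MvPowerSeries (Fin (m + 1)) k))
    (germ' := fun τ : SurfDatum k m × (Fin (m + 1) → ℕ × ℕ) => τ.1.b₀) (fun τ => (τ.1.b₀, τ.1.δ)) (fun _ => rfl)
    (Q := fun τ => (Admissible τ.1 τ.2 ∧ τ.2.head < σ.δ.head) ∨
      ∃ ρ : SurfDatum k m, (ρ.b₀, ρ.δ) = τ ∧ ρ.Valid ∧ ρ.δ.head = σ.δ.head ∧ ∀ l ∈ ρ.off, ρ.ψ l = 0)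
    (fun τ hτ => by
      rcases hτ with ⟨hadm, hlt⟩ | ⟨hv, hh, hz⟩
      · exact Or.inl ⟨hadm, by rw [← hhead]; exact hlt⟩
      · exact Or.inr ⟨τ.1, rfl, hv, by rw [hh, hhead], hz⟩)
  have hwin : DWinsTo (St := MvPowerSeries (Fin (m + 1)) k × Decoration k m) Prod.fst
      (fun τ => Admissible τ.1 τ.2 ∧ τ.2.head < σ.δ.head) ((σ.twist Θ).b₀, (σ.twist Θ).δ) := by
    refine hmap.bind fun τ hτ => ?_
    rcases hτ with hQ | ⟨ρ, hρτ, hρ, hρhead, hz⟩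
    · exact DWinsTo.of_target hQ
    · subst hρτ
      obtain ⟨hadm, hab, hψ, hperm, htwo⟩ := hρ
      have h := dWinsTo_headDrop_of_terminal hadm hm hab hψ (fun l hl hlab => hz l ((mem_off_iff ρ l).mpr ⟨hl, hlab⟩)) hperm htwo
      exact h.mono fun τ' hτ' => ⟨hτ'.1, by rw [← hρhead]; exact hτ'.2⟩
  -- pull back through the twist
  refine DWinsTo.of_twist (constantCoeff_baseChange hΘ0) (isUnit_det_baseChange hσ.2.1 hΘ0 hΘdet) hwin ?_
  rintro ⟨-, hlt⟩
  exact absurd (hhead ▸ hlt : (σ.twist Θ).δ.head < (σ.twist Θ).δ.head) (lt_irrefl _)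

end SurfDatum

/-- **THE LOOP `SurfLoop`** (OURS · L1 W4.3): from every admissibly decorated `SurfState` the mover forces «admissibly decorated of smaller head»
(`k` infinite, `m ≥ 2`).  Non-normal-crossing phase by point moves on the count of the shadow (part 21), then the normal-crossing phase. -/
theorem surfLoop (k : Type) [Field k] [Infinite k] {m : ℕ} (hm : 2 ≤ m) : SurfLoop k m := by
  intro b δ hadm hS
  obtain ⟨⟨a, b', ψ, hab, hψ, hperm⟩, htwo⟩ := hS
  set σ₀ : SurfDatum k m := ⟨b, δ, a, b', ψ⟩ with hσ₀
  have hval : σ₀.Valid := ⟨hadm, hab, hψ, hperm, htwo⟩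
  obtain ⟨ν, -, hν₂, hν₃⟩ := stub_planeCountRadical k
  have hph := SurfDatum.dWinsTo_ncShadow ν hν₂ hν₃ hval
  have hmap := hph.map (germ := (Prod.fst : MvPowerSeries (Fin (m + 1)) k × Decoration k m → MvPowerSeries (Fin (m + 1)) k))
    (germ' := SurfDatum.b₀) (fun τ => (τ.b₀, τ.δ)) (fun _ => rfl)
    (Q := fun τ => (Admissible τ.1 τ.2 ∧ τ.2.head < δ.head) ∨
      ∃ ρ : SurfDatum k m, (ρ.b₀, ρ.δ) = τ ∧ ρ.Valid ∧ ρ.δ.head = δ.head ∧ PlaneGerm.IsNC ρ.shadow)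
    (fun τ hτ => by
      rcases hτ with h | ⟨hv, hh, hnc⟩
      · exact Or.inl h
      · exact Or.inr ⟨τ, rfl, hv, hh, hnc⟩)
  refine hmap.bind fun τ hτ => ?_
  rcases hτ with hQ | ⟨ρ, hρτ, hρ, hρhead, hnc⟩
  · exact DWinsTo.of_target hQ
  · subst hρτ
    exact (SurfDatum.dWinsTo_of_ncShadow hm hρ hnc).mono fun τ' hτ' => ⟨hτ'.1, by rw [← hρhead]; exact hτ'.2⟩

/-- **THE SURFACE SUB-CASE OF THE LINE STUB `ApexPlaneExit`** (`ApexPlaneSurfaceExit k m`, part 17's statement), `k` infinite, `m ≥ 2`. -/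
theorem apexPlaneSurfaceExit (k : Type) [Field k] [Infinite k] {m : ℕ} (hm : 2 ≤ m) : ApexPlaneSurfaceExit k m :=
  apexPlaneSurfaceExit_of_surfLoop (surfLoop k hm)

/-- **res-L1-w43-strat-1's stub `stub_apexPlaneSurfaceThree` (sub-skeleton `pl3_split_v1` of the line `directrix-cut`, piece PL₃) — ITS TEXT, PROVED.**
At `m = 3` over an algebraically closed field of characteristic `p`: from an admissibly decorated `(b, δ)` with `o ≥ 2`, `O = ∅`, NOT unary, two
independent invariance vectors of `in_c g`, and a legal `Φ` with `c ≤ ord_{𝟙_{j ∉ {a,b'}}}(Φ^* g)` (a smooth formal surface germ inside the `c`-fold locus),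
the mover forces «NC, or admissibly decorated of smaller head».  (The hypotheses `O = ∅` and «two independent invariance vectors» are not used:
`¬ UnaryVertex` already gives apex dimension `≤ 2` at four letters, part 18.) -/
theorem apexPlaneSurfaceThree :
    ∀ (p : ℕ), p.Prime → ∀ (k : Type) [Field k] [CharP k p] [IsAlgClosed k],
      ∀ (b : MvPowerSeries (Fin 4) k) (δ : Decoration k 3), Admissible b δ → 2 ≤ δ.o → δ.O = ∅ → ¬ UnaryVertex δ →
        (∃ v₁ v₂ : Fin 4 → k,
          (∀ x : Fin 4 → k, CobordantChart.initEval (fun _ : Fin 4 => 1) (x + v₁) δ.c (δ.f * ∏ l ∈ δ.O, X l) =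
            CobordantChart.initEval (fun _ : Fin 4 => 1) x δ.c (δ.f * ∏ l ∈ δ.O, X l)) ∧
          (∀ x : Fin 4 → k, CobordantChart.initEval (fun _ : Fin 4 => 1) (x + v₂) δ.c (δ.f * ∏ l ∈ δ.O, X l) =
            CobordantChart.initEval (fun _ : Fin 4 => 1) x δ.c (δ.f * ∏ l ∈ δ.O, X l)) ∧
          ∀ α β : k, α • v₁ + β • v₂ = 0 → α = 0 ∧ β = 0) →
        (∃ (Φ : Fin 4 → MvPowerSeries (Fin 4) k) (a b' : Fin 4), (∀ l, constantCoeff (Φ l) = 0) ∧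
          IsUnit (Matrix.det (Matrix.of fun i j : Fin 4 => coeff (Finsupp.single j 1) (Φ i))) ∧ a ≠ b' ∧
          (δ.c : ℕ∞) ≤ (subst Φ (δ.f * ∏ l ∈ δ.O, X l)).weightedOrder (fun j => if j = a ∨ j = b' then 0 else 1)) →
        DWinsTo (St := MvPowerSeries (Fin 4) k × Decoration k 3) Prod.fst
          (fun τ => GermIsNC τ.1 ∨ (Admissible τ.1 τ.2 ∧ τ.2.head < δ.head)) (b, δ) := by
  intro p _ k _ _ _ b δ hadm ho _ hnU _ hS
  obtain ⟨Φ, a, b', hΦ0, hΦdet, hab, hin⟩ := hS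
  exact apexPlaneSurfaceExit k (m := 3) (by norm_num) b δ hadm ho (apexPlane_of_not_unaryVertex hnU)
    ⟨Φ, a, b', hΦ0, hΦdet, hab, inOffPlaneIdeal_of_le_weightedOrder hin⟩

end GraphSurf

end TameFourTupleDrop

end Summit.ResolutionOfSingularities.ResolutionOfSingularities.Theorems

end
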